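import Summits.CriticalPhenomena.CardyFormulaZ2.Theses.CardyWickAnisotropy

/-! Scratch (crux-strategist): the two prepared split children of `TaylorIdentification` + the generated glue statement, elaborated with the route file's `open` context (they need `open scoped Classical`). Kept in a scratch namespace so this file survives the real split (which will declare `Theses.CardyWickAnisotropy.FirstTwistedMoment / OddLevelSums / TaylorIdentificationGlue`). -/

namespace Summit.CriticalPhenomena.CardyFormulaZ2.Cruxes.AnisotropicBoxCardy.SplitRender

open Summit.CriticalPhenomena.CardyFormulaZ2.Theses.CardyWickAnisotropy (TaylorIdentification)

open scoped BigOperators Topology Manifold Classical MeasureTheory ProbabilityTheory Matrix InnerProductSpace ComplexConjugate ContinuousMap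
open Filter Set Function TopologicalSpace MeasureTheory

/-- child 1 (k = 1 rung). -/
def FirstTwistedMoment : Prop :=
  let E : ℕ → Finset (Sym2 (Literature.Probability.LatticeModels.Site 2)) := fun n ↦ ((Literature.Probability.Percolation.rectangle (n + 1) n ×ˢ Literature.Probability.Percolation.rectangle (n + 1) n).filter (fun xy ↦ (Literature.Probability.LatticeModels.zdGraph 2).Adj xy.1 xy.2)).image (fun xy ↦ s(xy.1, xy.2)); let Piv : ℕ → ℝ := fun n ↦ ∑ e ∈ E n, (if (∃ x y : Literature.Probability.LatticeModels.Site 2, e = s(x, y) ∧ x 1 = y 1) then (1:ℝ) else -1) * (2 * ((((E n).erase e).powerset.filter (fun ω ↦ ((↑(insert e ω) : Set (Sym2 (Literature.Probability.LatticeModels.Site 2))) ∈ Literature.Probability.Percolation.lrCrossing (n + 1) n) ∧ ((↑ω : Set (Sym2 (Literature.Probability.LatticeModels.Site 2))) ∉ Literature.Probability.Percolation.lrCrossing (n + 1) n))).card : ℝ) / (2:ℝ) ^ (E n).card); let c₁ : ℝ := 2 * Real.sqrt 3 * (Literature.Probability.RandomPlanarGeometry.cardyConst / 3) * (1 / 4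 : ℝ) ^ (-(2 / 3 : ℝ)) * (Real.pi / 2) * (Literature.NumberTheory.EllipticCurves.JacobiThetaNull.theta4 Complex.I).re ^ 4; Filter.Tendsto (fun n : ℕ ↦ Piv n) Filter.atTop (nhds c₁)

/-- child 2 (odd k ≥ 3). -/
def OddLevelSums : Prop :=
  let E : ℕ → Finset (Sym2 (Literature.Probability.LatticeModels.Site 2)) := fun n ↦ ((Literature.Probability.Percolation.rectangle (n + 1) n ×ˢ Literature.Probability.Percolation.rectangle (n + 1) n).filter (fun xy ↦ (Literature.Probability.LatticeModels.zdGraph 2).Adj xy.1 xy.2)).image (fun xy ↦ s(xy.1, xy.2)); let W : ℕ → ℕ → ℝ := fun n k ↦ ∑ T ∈ (E n).powersetCard k, (-1 : ℝ) ^ (T.filter (fun e ↦ ¬ ∃ x y : Literature.Probability.LatticeModels.Site 2, e = s(x, y) ∧ x 1 = y 1)).card * ((∑ ω ∈ (E n).powerset, (if ((ω : Set (Sym2 (Literature.Probability.LatticeModels.Site 2))) ∈ Literature.Probability.Percolation.lrCrossing (n + 1) n) then (-1 : ℝ) ^ (T \ ω).card else 0)) / (2 : ℝ) ^ (E n).card);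 let PiH : ℝ → ℝ := fun r ↦ Literature.Probability.RandomPlanarGeometry.cardyFunction (((Literature.NumberTheory.EllipticCurves.JacobiThetaNull.theta2 (Complex.I * (r : ℂ)) / Literature.NumberTheory.EllipticCurves.JacobiThetaNull.theta3 (Complex.I * (r : ℂ))) ^ 4).re); ∀ G : ℂ → ℂ, DifferentiableOn ℂ G (Metric.ball ((1:ℂ) / 2) (1 / 2)) → (∀ α ∈ Set.Ioo (0:ℝ) Real.pi, G ((Literature.Probability.LatticeModels.criticalWeight (α / 2) : ℝ) : ℂ) = ((PiH (Real.cos (α / 2) / Real.sin (α / 2)) : ℝ) : ℂ)) → ∀ k : ℕ, Odd k → 3 ≤ k → Filter.Tendsto (fun n : ℕ ↦ ((((k.factorial : ℝ) * 2 ^ k * W n k : ℝ)) : ℂ)) Filter.atTop (nhds (iteratedDeriv k G ((1:ℂ) / 2)))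

/-- generated glue statement. -/
def TaylorIdentificationGlue : Prop :=
  FirstTwistedMoment → OddLevelSums → TaylorIdentification

end Summit.CriticalPhenomena.CardyFormulaZ2.Cruxes.AnisotropicBoxCardy.SplitRender
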